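import Literature.NumberTheory.GaloisCohomology.LocalInvariantMap
import Literature.AnabelianGeometry.AbsoluteAnabelian.LocalResidueMapRestrictionIndex
import HarnessLib

/-!
# Evaluation of the local invariant map on cyclic classes `κₙ(x) ∪ χ`
# (Serre, *Corps locaux* XIII §4 Prop. 13, XIV §1 Prop. 3 — the unramified case)

Let `F` be a non-archimedean local field of characteristic `0`, `n ≥ 1`, `χ` the normalised
unramified character of level `n` (`χ(I_F) = 0`, `χ(Frob) = 1`, as the crossed homomorphism
`σ ↦ (χ σ)·id ∈ μₙ^∨(1)`, `Prop121vii.scalarCocycle`) and `x ∈ Fˣ` with Kummer class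
`κₙ(x) = δ₀(x) ∈ H¹(Γ_F, μₙ)`.  THE residue map `inv = Prop121vii.invLevel F n` of the tree
(`LocalResidueMapQmodZ.lean`; characterised by `inv(κₙ(π) ∪ χ) = 1`) satisfies

  `inv (κₙ(x) ∪ χ) = ord_F(x)`                                    (`invLevel_cupProduct_δ₀`)

(Serre XIV §1 Prop. 3 with XIII §4 Prop. 13: `(χ, x) ↦ v(x)·χ(Frob)`): write `x = u · ϖ^{ord x}`,
units contribute nothing (they are norms from the unramified extension; in the tree
`Prop121vii.exists_normalizedCharacter` (b) + the cochain identity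
`Prop121vii.cohomologyMap_kummerι_cupProduct_δ₀_scalar` + injectivity of `H²(μₙ) → H²(F̄ˣ)`,
`kummerTwoOntoTorsion_holds`), and the uniformiser contributes `1`.  This is the computation done
inline in the tree's `Prop121vii.invLevel_resMu` (`LocalResidueMapRestrictionIndex.lean`), isolated
here as a statement, together with its consequences for a number field `K` and a finite place `v`:

* `localInvariantMap_localization` — dictionary: the Poitou–Tate family component
  `localInvariantMap K n v` (file `LocalInvariantMap.lean`) evaluated on the localisation
  `loc_v c` of a global class `c ∈ H²(Γ_K, μₙ)` IS `invLevel (K_v) n (Res_{K_v/K} c)` for the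
  anabelian restriction `Prop121vii.resMu K K_v n 2` (`LocalResidueMapRestriction.lean`);
* `exists_apply_absGaloisRestrict_eq_mul` — a global cyclic character `ψ : Γ_K ↠ ℤ/n` whose
  restriction to `Γ_{K_v}` kills the inertia group `I_{K_v}` ("`ψ` unramified at `v`") restricts to
  `f · χ_v` for the normalised unramified character `χ_v` of `K_v`, `f = ψ(Frob_v)` (Weil density,
  `IsNonarchimedeanLocalField.range_eq_zpowers_of_absInertia_le_ker`);
* `localInvariantMap_localization_cupProduct_δ₀` — **`inv_v (loc_v (κₙ(x) ∪ ψ)) = f · ord_v(x)`**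
  for such `ψ`, `x ∈ Kˣ`: the local invariant of a global cyclic class at a place where the
  character is unramified (Serre XIV §1 Prop. 3; Cassels–Fröhlich VII §9.6; the step
  `inv_v((χ, b)) = v(b)·χ(Frob_v)` of Tate's proof of the reciprocity law, Cassels–Fröhlich VII §10).

Used by the tree's discharge of `poitouTate_sum_localTatePairing_eq_zero` (Albert–Brauer–Hasse–
Noether for THE invariant maps): proof file, theorems only, no named fact, no instance (D-0026).

## References

* J.-P. Serre, *Corps locaux* / *Local Fields* (1979), XIII §3 Prop. 6–7, XIII §4 Prop. 13,
  XIV §1 Prop. 2–3. [SerreLocalFields1979]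
* J. W. S. Cassels, A. Fröhlich (eds.), *Algebraic Number Theory* (1967), Ch. VI (Serre) §1.1,
  Ch. VII (Tate) §9.6, §10, §11.2. [CasselsFrohlichANT1967]
* J. S. Milne, *Arithmetic Duality Theorems*, 2nd ed. (2006), I §1, Ex. 1.6 (b). [MilneADT2006]

## Tree search

`lean search 'invLevel_cupProduct|localInvariantMap_localization|apply_absGaloisRestrict_eq_mul'`:
no prior declaration.  Inputs: `Prop121vii.invLevel/isInvariantMap_invLevel/resMu/
resMu_cupProduct_δ₀_scalarCocycle/exists_normalizedCharacter/normalizedUnramifiedCocycle_unique/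
cohomologyMap_kummerι_cupProduct_δ₀_scalar/baseUnitsInvariant`, `kummerTwoOntoTorsion_holds`,
`muLocalIso`, `localInvariantMap`, Mathlib `ContinuousCohomology.map_comp`.
-/

noncomputable section

open CategoryTheory Function NumberField IsDedekindDomain Field ValuativeRel
open scoped NumberField Valued

universe u

namespace Literature.NumberTheory.GaloisCohomology

open _root_.ContinuousCohomology
open Literature.NumberTheory.GaloisRepresentations
open Literature.NumberTheory.GaloisRepresentations.DiscreteGaloisModule
open Literature.NumberTheory.GaloisRepresentations.LocalWeilDatum
open Literature.NumberTheory.GaloisRepresentations.IsNonarchimedeanLocalField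
open Literature.AnabelianGeometry.AbsoluteAnabelian
open Literature.AnabelianGeometry.AbsoluteAnabelian.Prop121vii

/-! ### §1. Dictionary: `localInvariantMap` on localisations is `invLevel ∘ Res` -/

section Dictionary

variable {K : Type u} [Field K] [NumberField K] {n : ℕ} [NeZero n] (v : HeightOneSpectrum (𝓞 K))


/-- `ContinuousCohomology.map` along equal group homomorphisms and pointwise equal coefficient
morphisms agree (the tree's `contMap_congr` of `KummerReciprocityFunctoriality.lean`, restated to
avoid the import). [folklore] -/
private theorem contMap_congr' {k : Type*} [Ring k] [TopologicalSpace k] {G H : Type u} [Group G]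
    [TopologicalSpace G] [IsTopologicalGroup G] [Group H] [TopologicalSpace H] [IsTopologicalGroup H]
    {X : TopRep k G} {Y : TopRep k H} {φ ψ : H →ₜ* G} (h : φ = ψ)
    (f : TopRep.res (φ : H →* G) X ⟶ Y) (g : TopRep.res (ψ : H →* G) X ⟶ Y)
    (hfg : ∀ x, f.hom x = g.hom x) (m : ℕ) :
    ContinuousCohomology.map φ f m = ContinuousCohomology.map ψ g m := by
  subst h
  have : f = g := TopRep.hom_ext (ContIntertwiningMap.ext (ContinuousLinearMap.ext hfg))
  rw [this]

/-- **The localisation of `μₙ`-classes, in the anabelian dialect**: transporting the localisation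
`loc_v c ∈ H^k(Γ_{K_v}, μₙ(K̄)|)` of a global class along `μₙ(K̄)| ≅ μₙ(K̄_v)` (`muLocalIso`) gives
the restriction `Res_{K_v/K} c` of `LocalResidueMapRestriction.lean` (`Prop121vii.resMu`): both are
"pull back along `Γ_{K_v} → Γ_K`, push the coefficients along `K̄ → K̄_v`"
(Mathlib `ContinuousCohomology.map_comp`): the restriction `H^k(G_K, A) → H^k(G_{K_v}, A)` of a
compatible pair. [cite: SerreGaloisCohomology1997, I §2.4] -/
theorem cohomologyMap_muLocalIso_localization (k : ℕ) (c : galoisCohomology (mu K n) k) :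
    (cohomologyMap (muLocalIso v n).hom k).hom (galoisCohomology.localization (mu K n) (Sum.inr v) k c) =
      resMu K (v.adicCompletion K) n k c := by
  have key : ContinuousCohomology.map (absGaloisRestrict K (v.adicCompletion K))
        (TopRep.ofHom ⟨ContinuousLinearMap.id ℤ (MuCarrier K n), fun _ => rfl⟩) k ≫
      ContinuousCohomology.map (ContinuousMonoidHom.id _) (resIdHom (muLocalIso v n).hom) k =
    ContinuousCohomology.map (absGaloisRestrict K (v.adicCompletion K))
      (resCoeff K (v.adicCompletion K) n) k := by
    rw [← ContinuousCohomology.map_comp]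
    exact contMap_congr' (ContinuousMonoidHom.ext fun _ => rfl) _ _
      (fun x => muVal_injective (v.adicCompletion K) n rfl) k
  exact congrArg (fun T => (ConcreteCategory.hom T) c) key

/-- **`inv_v (loc_v c) = invLevel (K_v) n (Res_{K_v/K} c)`**: the finite component
`localInvariantMap K n v` of the Poitou–Tate family of invariant maps (`LocalInvariantMap.lean`),
evaluated on the localisation of a global class `c ∈ H²(Γ_K, μₙ)`, is THE residue map of the local
field `K_v` on the restriction `Res_{K_v/K} c` of the anabelian files (Milne's `inv_v` on
`H²(K_v, μₙ) = Br(K_v)[n]`, I §1). [cite: MilneADT2006, Ch. I §1, Ex. 1.6 (b)] -/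
theorem localInvariantMap_localization (c : galoisCohomology (mu K n) 2) :
    localInvariantMap K n v (galoisCohomology.localization (mu K n) (Sum.inr v) 2 c) =
      haveI : CharZero (v.adicCompletion K) := charZero_adicCompletion v
      invLevel (v.adicCompletion K) n (resMu K (v.adicCompletion K) n 2 c) := by
  haveI : CharZero (v.adicCompletion K) := charZero_adicCompletion v
  rw [localInvariantMap_apply, ← cohomologyMap_muLocalIso_localization]

end Dictionary

/-! ### §2. Local evaluation: `inv (κₙ(x) ∪ χ) = ord x` for the normalised unramified `χ` -/

section BaseInvariant

variable (F : Type u) [Field F]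

/-- `baseUnitsInvariant` only depends on the element. [folklore] -/
private theorem baseUnitsInvariant_congr' {x y : F} (hx : x ≠ 0) (hy : y ≠ 0) (h : x = y) :
    baseUnitsInvariant F x hx = baseUnitsInvariant F y hy := by
  subst h; rfl

/-- `baseUnitsInvariant F 1 = 0` (`H⁰(G_K, K̄ˣ) = Kˣ` is a group homomorphism image).
[cite: SerreGaloisCohomology1997, II §1.2] -/
theorem baseUnitsInvariant_one : baseUnitsInvariant F (1 : F) one_ne_zero = 0 := by
  have h := baseUnitsInvariant_mul F 1 1 one_ne_zero one_ne_zero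
  rw [baseUnitsInvariant_congr' F (mul_ne_zero one_ne_zero one_ne_zero) one_ne_zero (mul_one 1)] at h
  exact left_eq_add.1 h

/-- `baseUnitsInvariant` on integer powers: `x ^ k ↦ k • (x)` (`H⁰(G_K, K̄ˣ) = Kˣ`).
[cite: SerreGaloisCohomology1997, II §1.2] -/
theorem baseUnitsInvariant_zpow (x : F) (hx : x ≠ 0) (k : ℤ) :
    baseUnitsInvariant F (x ^ k) (zpow_ne_zero k hx) = k • baseUnitsInvariant F x hx := by
  obtain ⟨m, rfl | rfl⟩ := Int.eq_nat_or_neg k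
  · rw [baseUnitsInvariant_congr' F (zpow_ne_zero _ hx) (pow_ne_zero m hx) (zpow_natCast x m),
      baseUnitsInvariant_pow]
  · have hm : x ^ (-(m : ℤ)) * x ^ m = 1 := by
      rw [zpow_neg, zpow_natCast, inv_mul_cancel₀ (pow_ne_zero m hx)]
    have h := baseUnitsInvariant_mul F (x ^ (-(m : ℤ))) (x ^ m) (zpow_ne_zero _ hx) (pow_ne_zero m hx)
    rw [baseUnitsInvariant_congr' F (mul_ne_zero (zpow_ne_zero _ hx) (pow_ne_zero m hx)) one_ne_zero hm,
      baseUnitsInvariant_one, baseUnitsInvariant_pow] at h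
    rw [neg_smul, eq_neg_iff_add_eq_zero]
    exact h.symm

end BaseInvariant

section Local

variable (F : Type u) [Field F] [ValuativeRel F] [TopologicalSpace F] [IsNonarchimedeanLocalField F]
  [CharZero F] {n : ℕ} [NeZero n]


/-- **Units contribute nothing: `κₙ(u) ∪ χ = 0` for `|u| = 1`** and the normalised unramified
character `χ` (units are norms from the unramified extension of degree `n`, Serre XIII §3 Prop. 6;
in the tree: `Prop121vii.exists_normalizedCharacter` (b) for ITS character `χ₀`, transported to any
normalised `χ` by `normalizedUnramifiedCocycle_unique`, then the cochain identity
`Kummer(κₙ(u) ∪ χ₀) = −κ_{χ₀}(u)` and injectivity of `H²(μₙ) → H²(F̄ˣ)`).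
[cite: SerreLocalFields1979, XIII §3 Prop. 6] -/
theorem cupProduct_δ₀_scalarCocycle_eq_zero_of_valuation_eq_one
    (ψ : CyclicCharacter (absoluteGaloisGroup F) n)
    (hI : ∀ σ ∈ absInertia F, ψ σ = 0) (hF : ∀ σ : absoluteGaloisGroup F, IsFrobPow σ 1 → ψ σ = 1)
    (x : F) (hx : x ≠ 0) (hx1 : valuation F x = 1) :
    haveI : CompactSpace (absoluteGaloisGroup F) := absoluteGaloisGroup_compactSpace F
    ((mu F n).tateDualPairing n).cupProduct
        ((isSES_kummer F n (NeZero.pos n)).δ₀ (baseUnitsInvariant F x hx))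
        (oneCocycleClass _ (scalarCocycle ψ)) = 0 := by
  haveI : CompactSpace (absoluteGaloisGroup F) := absoluteGaloisGroup_compactSpace F
  rcases Nat.lt_or_ge 1 n with hn1 | hn1
  swap
  · have hn : n = 1 := le_antisymm hn1 (NeZero.pos n)
    subst hn
    -- `ℤ/1`-coefficients: `invLevel` is a bijection onto the trivial group
    apply (isInvariantMap_invLevel F 1).1.1
    exact Subsingleton.elim _ _
  obtain ⟨ψ₀, hI₀, hF₀, -, hunit⟩ := exists_normalizedCharacter F n hn1
  have heq : scalarCocycle ψ = scalarCocycle ψ₀ :=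
    normalizedUnramifiedCocycle_unique F (isNormalizedUnramifiedCocycle_scalarCocycle F ψ hI hF)
      (isNormalizedUnramifiedCocycle_scalarCocycle F ψ₀ hI₀ hF₀)
  rw [heq]
  have h := cohomologyMap_kummerι_cupProduct_δ₀_scalar ψ₀ (scalarCocycle ψ₀) (scalarCocycle_apply ψ₀)
    (baseUnitsInvariant F x hx)
  rw [hunit x hx hx1 _ (coe_unitsVal_baseUnitsInvariant F x hx), neg_zero] at h
  exact (kummerTwoOntoTorsion_holds F n).1 (h.trans (map_zero _).symm)

/-- **`inv (κₙ(x) ∪ χ) = ord_F(x)`** for THE residue map `invLevel F n`, the normalised unramified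
character `χ` (`χ(I_F) = 0`, `χ(Frob) = 1`) and every `x ∈ Fˣ` — Serre's normalisation
`(χ, x) ↦ v(x)·χ(Frob)` (XIV §1 Prop. 3 with XIII §4 Prop. 13) extended from uniformisers (the
defining property `IsInvariantMap`) to all of `Fˣ`: `x = u·ϖ^{ord x}` with `u` a unit, `δ₀` and the
cup product are additive, the unit contributes `0`
(`cupProduct_δ₀_scalarCocycle_eq_zero_of_valuation_eq_one`) and `ϖ` contributes `1`.
[cite: SerreLocalFields1979, XIV §1 Prop. 3] -/
theorem invLevel_cupProduct_δ₀ (ψ : CyclicCharacter (absoluteGaloisGroup F) n)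
    (hI : ∀ σ ∈ absInertia F, ψ σ = 0) (hF : ∀ σ : absoluteGaloisGroup F, IsFrobPow σ 1 → ψ σ = 1)
    (x : F) (hx : x ≠ 0) :
    haveI : CompactSpace (absoluteGaloisGroup F) := absoluteGaloisGroup_compactSpace F
    invLevel F n (((mu F n).tateDualPairing n).cupProduct
        ((isSES_kummer F n (NeZero.pos n)).δ₀ (baseUnitsInvariant F x hx))
        (oneCocycleClass _ (scalarCocycle ψ))) = (ord F x : ZMod n) := by
  classical
  haveI : CompactSpace (absoluteGaloisGroup F) := absoluteGaloisGroup_compactSpace F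
  -- a uniformiser `ϖ` and the factorisation `x = u · ϖ ^ ord x`
  obtain ⟨ϖ, hϖ⟩ := IsDiscreteValuationRing.exists_irreducible 𝒪[F]
  have hπ0 : (ϖ : F) ≠ 0 := fun h => hϖ.ne_zero (Subtype.ext h)
  have hπ : (valuation F).IsUniformizer (ϖ : F) := (ord_eq_one_iff F hπ0).1 (ord_eq_one_of_irreducible F hϖ)
  set k : ℤ := ord F x with hk
  set u : F := x / (ϖ : F) ^ k with hu
  have hu0 : u ≠ 0 := div_ne_zero hx (zpow_ne_zero k hπ0)
  have hordzpow : ord F ((ϖ : F) ^ k) = k := by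
    obtain ⟨m, hm | hm⟩ := Int.eq_nat_or_neg k
    · rw [hm, zpow_natCast, ord_pow F hπ0, ord_eq_one_of_irreducible F hϖ, mul_one]
    · have h1 : ord F ((ϖ : F) ^ (m : ℤ)) = m := by
        rw [zpow_natCast, ord_pow F hπ0, ord_eq_one_of_irreducible F hϖ, mul_one]
      have h2 := ord_mul F (zpow_ne_zero (-(m : ℤ)) hπ0) (zpow_ne_zero (m : ℤ) hπ0)
      rw [← zpow_add₀ hπ0, neg_add_cancel, zpow_zero, ord_one, h1] at h2
      rw [hm]; omega
  have hu1 : valuation F u = 1 := by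
    rw [← ord_eq_zero_iff F hu0, hu, ord_div F hx (zpow_ne_zero k hπ0), hordzpow, hk, sub_self]
  have hux : u * (ϖ : F) ^ k = x := div_mul_cancel₀ _ (zpow_ne_zero k hπ0)
  -- the base invariants
  set ux := baseUnitsInvariant F x hx with hux'
  set uu := baseUnitsInvariant F u hu0 with huu
  set uπ := baseUnitsInvariant F (ϖ : F) hπ0 with huπ
  have hdec : ux = uu + k • uπ := by
    rw [hux', huu, huπ, ← baseUnitsInvariant_zpow, ← baseUnitsInvariant_mul]
    exact baseUnitsInvariant_congr' F _ _ hux.symm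
  -- carrier-typed aliases
  let ι : continuousCohomology 2 (mu F n).toTopRep →+ ZMod n := invLevel F n
  let P := (mu F n).tateDualPairing n
  let g := oneCocycleClass ((mu F n).tateDual n).toTopRep (scalarCocycle ψ)
  let δ := (isSES_kummer F n (NeZero.pos n)).δ₀
  have hadd : ∀ a b : continuousCohomology 1 (mu F n).toTopRep,
      P.cupProduct (a + b) g = P.cupProduct a g + P.cupProduct b g := fun a b => by
    rw [map_add, LinearMap.add_apply]
  have hzsmul : ∀ (m : ℤ) (a : continuousCohomology 1 (mu F n).toTopRep),
      P.cupProduct (m • a) g = m • P.cupProduct a g := fun m a =>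
    map_zsmul (AddMonoidHom.mk' (fun a => P.cupProduct a g) hadd) m a
  have hone : ι (P.cupProduct (δ uπ) g) = 1 :=
    (isInvariantMap_invLevel F n).2 (scalarCocycle ψ) (isNormalizedUnramifiedCocycle_scalarCocycle F ψ hI hF)
      (ϖ : F) hπ uπ (coe_unitsVal_baseUnitsInvariant F _ hπ0)
  have hunit : P.cupProduct (δ uu) g = 0 :=
    cupProduct_δ₀_scalarCocycle_eq_zero_of_valuation_eq_one F ψ hI hF u hu0 hu1
  change ι (P.cupProduct (δ ux) g) = (k : ZMod n)
  rw [hdec, map_add δ, map_zsmul δ, hadd, hzsmul, hunit, zero_add, map_zsmul ι, hone, zsmul_eq_mul,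
    mul_one]

/-- **Multiples: `inv (κₙ(x^f) ∪ χ) = f · ord_F(x)`** (the shape produced by restriction of global
cyclic classes, `Prop121vii.resMu_cupProduct_δ₀_scalarCocycle`). [cite: SerreLocalFields1979, XIV §1 Prop. 3] -/
theorem invLevel_cupProduct_δ₀_zsmul (ψ : CyclicCharacter (absoluteGaloisGroup F) n)
    (hI : ∀ σ ∈ absInertia F, ψ σ = 0) (hF : ∀ σ : absoluteGaloisGroup F, IsFrobPow σ 1 → ψ σ = 1)
    (f : ℤ) (x : F) (hx : x ≠ 0) :
    haveI : CompactSpace (absoluteGaloisGroup F) := absoluteGaloisGroup_compactSpace F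
    invLevel F n (((mu F n).tateDualPairing n).cupProduct
        ((isSES_kummer F n (NeZero.pos n)).δ₀ (f • baseUnitsInvariant F x hx))
        (oneCocycleClass _ (scalarCocycle ψ))) = (f : ZMod n) * (ord F x : ZMod n) := by
  haveI : CompactSpace (absoluteGaloisGroup F) := absoluteGaloisGroup_compactSpace F
  let P := (mu F n).tateDualPairing n
  let g := oneCocycleClass ((mu F n).tateDual n).toTopRep (scalarCocycle ψ)
  have hadd : ∀ a b : continuousCohomology 1 (mu F n).toTopRep,
      P.cupProduct (a + b) g = P.cupProduct a g + P.cupProduct b g := fun a b => by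
    rw [map_add, LinearMap.add_apply]
  have hzsmul : ∀ (m : ℤ) (a : continuousCohomology 1 (mu F n).toTopRep),
      P.cupProduct (m • a) g = m • P.cupProduct a g := fun m a =>
    map_zsmul (AddMonoidHom.mk' (fun a => P.cupProduct a g) hadd) m a
  let ι : continuousCohomology 2 (mu F n).toTopRep →+ ZMod n := invLevel F n
  have hι : ι (P.cupProduct ((isSES_kummer F n (NeZero.pos n)).δ₀ (baseUnitsInvariant F x hx)) g) =
      (ord F x : ZMod n) := invLevel_cupProduct_δ₀ F ψ hI hF x hx
  change ι (P.cupProduct _ g) = _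
  rw [map_zsmul, hzsmul, map_zsmul ι, hι, zsmul_eq_mul]

end Local

/-! ### §3. A global character unramified at `v` restricts to `f · χ_v` -/

section Unramified

variable {K : Type u} [Field K] (E : Type u) [Field E] [Algebra K E] [ValuativeRel E]
  [TopologicalSpace E] [IsNonarchimedeanLocalField E] {n : ℕ} [NeZero n]

/-- **A character whose restriction kills inertia is a multiple of the normalised unramified
character**: for a cyclic character `ψ : Γ_K → ℤ/n` of a field `K`, an extension `E/K` which is a
non-archimedean local field (a completion), the normalised unramified character `χ_E` of `E`
(`χ_E(I_E) = 0`, `χ_E(Frob) = 1`), if `ψ ∘ res` kills the inertia group `I_E` then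
`ψ ∘ res = f · χ_E` with `f = ψ(res Φ) ∈ ℤ/n` for every arithmetic Frobenius lift `Φ ∈ Γ_E`
(`Γ_E / I_E` is topologically generated by Frobenius: Weil density,
`IsNonarchimedeanLocalField.range_eq_zpowers_of_absInertia_le_ker`).
[cite: SerreLocalFields1979, XIII §4 Prop. 13] -/
theorem exists_apply_absGaloisRestrict_eq_mul (ψ : CyclicCharacter (absoluteGaloisGroup K) n)
    (hψI : ∀ σ ∈ absInertia E, ψ (absGaloisRestrict K E σ) = 0)
    (ψE : CyclicCharacter (absoluteGaloisGroup E) n)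
    (hIE : ∀ σ ∈ absInertia E, ψE σ = 0) (hFE : ∀ σ : absoluteGaloisGroup E, IsFrobPow σ 1 → ψE σ = 1) :
    ∃ f : ℕ, (∀ σ : absoluteGaloisGroup E, ψ (absGaloisRestrict K E σ) = (f : ZMod n) * ψE σ) ∧
      ∀ φ : absoluteGaloisGroup E, IsFrobPow φ 1 → ψ (absGaloisRestrict K E φ) = (f : ZMod n) := by
  obtain ⟨φ₀, hφ₀⟩ := exists_isAbsArithFrob_holds E
  have hφ₀1 : IsFrobPow φ₀ 1 := IsAbsArithFrob.isFrobPow_holds hφ₀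
  set f : ℕ := (ψ (absGaloisRestrict K E φ₀)).val with hfdef
  have hf : (f : ZMod n) = ψ (absGaloisRestrict K E φ₀) := by rw [hfdef, ZMod.natCast_zmod_val]
  -- the difference character `d : Γ_E → ℤ/n` (written multiplicatively)
  let d : absoluteGaloisGroup E →* Multiplicative (ZMod n) :=
    { toFun := fun τ => Multiplicative.ofAdd (ψ (absGaloisRestrict K E τ) - (f : ZMod n) * ψE τ)
      map_one' := by rw [map_one, ψ.map_one, ψE.map_one, mul_zero, sub_zero]; rfl
      map_mul' := fun τ τ' => by
        rw [← ofAdd_add, map_mul, ψ.map_mul, ψE.map_mul]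
        congr 1
        ring }
  have hd : ∀ τ, d τ = Multiplicative.ofAdd (ψ (absGaloisRestrict K E τ) - (f : ZMod n) * ψE τ) :=
    fun τ => rfl
  have hcont : Continuous fun τ : absoluteGaloisGroup E =>
      ψ (absGaloisRestrict K E τ) - (f : ZMod n) * ψE τ := by
    have h1 : Continuous fun τ : absoluteGaloisGroup E => (ψ (absGaloisRestrict K E τ), ψE τ) :=
      (ψ.continuous.comp (absGaloisRestrict K E).continuous).prodMk ψE.continuous
    exact (continuous_of_discreteTopology (f := fun p : ZMod n × ZMod n => p.1 - (f : ZMod n) * p.2)).comp h1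
  have hker : (d.ker : Set (absoluteGaloisGroup E)) =
      (fun τ => ψ (absGaloisRestrict K E τ) - (f : ZMod n) * ψE τ) ⁻¹' {0} := by
    ext τ
    simp only [SetLike.mem_coe, MonoidHom.mem_ker, Set.mem_preimage, Set.mem_singleton_iff, hd]
    exact ⟨fun h => Multiplicative.ofAdd.injective (h.trans ofAdd_zero.symm),
      fun h => by rw [h, ofAdd_zero]⟩
  have hopen : IsOpen ((d.ker : Subgroup _) : Set (absoluteGaloisGroup E)) := by
    rw [hker]
    exact (isOpen_discrete _).preimage hcont
  have hIker : absInertia E ≤ d.ker := fun τ hτ => by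
    rw [MonoidHom.mem_ker, hd, hψI τ hτ, hIE τ hτ, mul_zero, sub_zero, ofAdd_zero]
  have hdφ : d φ₀ = 1 := by
    rw [hd, hFE φ₀ hφ₀1, mul_one, ← hf, sub_self, ofAdd_zero]
  have hrange := IsNonarchimedeanLocalField.range_eq_zpowers_of_absInertia_le_ker d hopen hIker hφ₀
  rw [hdφ, Subgroup.zpowers_one_eq_bot] at hrange
  have hzero : ∀ σ : absoluteGaloisGroup E, ψ (absGaloisRestrict K E σ) = (f : ZMod n) * ψE σ := by
    intro σ
    have hσ : d σ ∈ d.range := ⟨σ, rfl⟩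
    rw [hrange, Subgroup.mem_bot, hd] at hσ
    exact sub_eq_zero.1 (Multiplicative.ofAdd.injective (hσ.trans ofAdd_zero.symm))
  refine ⟨f, hzero, fun φ hφ => ?_⟩
  rw [hzero φ, hFE φ hφ, mul_one]

end Unramified

/-! ### §4. The local invariant of a global cyclic class at an unramified place -/

section Global

variable {K : Type u} [Field K] [NumberField K] {n : ℕ} [NeZero n] (v : HeightOneSpectrum (𝓞 K))


/-- **`inv_v (loc_v (κₙ(x) ∪ ψ)) = f · ord_v(x)`.**  Let `K` be a number field, `v` a finite place,
`ψ : Γ_K ↠ ℤ/n` a cyclic character whose restriction to `Γ_{K_v}` is `f · χ_v` for the normalised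
unramified character `χ_v` of `K_v` (i.e. `ψ` is unramified at `v` with `ψ(Frob_v) = f`,
`exists_apply_absGaloisRestrict_eq_mul`), and `x ∈ Kˣ`.  Then the local invariant at `v`
(`localInvariantMap K n v`, THE residue map of `K_v`) of the global cyclic class
`κₙ(x) ∪ ψ ∈ H²(Γ_K, μₙ)` is `f · ord_v(x)` — the local norm residue symbol at an unramified
place, `inv_v((χ, b)_v) = v(b) · χ(Frob_v)` (Serre XIV §1 Prop. 3; the step of Tate's proof of the
reciprocity law, Cassels–Fröhlich VII §10).  Proof: the restriction of the class is
`κₙ(x^f)_v ∪ χ_v` (`Prop121vii.resMu_cupProduct_δ₀_scalarCocycle`), evaluated by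
`invLevel_cupProduct_δ₀_zsmul`. [cite: SerreLocalFields1979, XIV §1 Prop. 3]
[cite: CasselsFrohlichANT1967, Ch. VII §10] -/
theorem localInvariantMap_localization_cupProduct_δ₀ (ψ : CyclicCharacter (absoluteGaloisGroup K) n)
    (ψE : CyclicCharacter (absoluteGaloisGroup (v.adicCompletion K)) n)
    (hIE : ∀ σ ∈ absInertia (v.adicCompletion K), ψE σ = 0)
    (hFE : ∀ σ : absoluteGaloisGroup (v.adicCompletion K), IsFrobPow σ 1 → ψE σ = 1)
    {f : ℕ} (hψ : ∀ σ : absoluteGaloisGroup (v.adicCompletion K),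
      ψ (absGaloisRestrict K (v.adicCompletion K) σ) = (f : ZMod n) * ψE σ)
    (x : K) (hx : x ≠ 0) :
    haveI : CompactSpace (absoluteGaloisGroup K) := absoluteGaloisGroup_compactSpace K
    localInvariantMap K n v (galoisCohomology.localization (mu K n) (Sum.inr v) 2
        (((mu K n).tateDualPairing n).cupProduct
          ((isSES_kummer K n (NeZero.pos n)).δ₀ (baseUnitsInvariant K x hx))
          (oneCocycleClass _ (scalarCocycle ψ)))) =
      (f : ZMod n) * (ord (v.adicCompletion K) (algebraMap K (v.adicCompletion K) x) : ZMod n) := by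
  haveI : CompactSpace (absoluteGaloisGroup K) := absoluteGaloisGroup_compactSpace K
  haveI : CompactSpace (absoluteGaloisGroup (v.adicCompletion K)) :=
    absoluteGaloisGroup_compactSpace (v.adicCompletion K)
  haveI : CharZero (v.adicCompletion K) := charZero_adicCompletion v
  have hx' : algebraMap K (v.adicCompletion K) x ≠ 0 := (map_ne_zero_iff _ (algebraMap K _).injective).2 hx
  rw [localInvariantMap_localization]
  have hres := resMu_cupProduct_δ₀_scalarCocycle K (v.adicCompletion K) ψ ψE hψ x hx hx'
  change invLevel (v.adicCompletion K) n (resMu K (v.adicCompletion K) n 2 _) = _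
  rw [hres]
  have h := invLevel_cupProduct_δ₀_zsmul (v.adicCompletion K) ψE hIE hFE (f : ℤ) _ hx'
  rwa [Int.cast_natCast] at h

end Global

end Literature.NumberTheory.GaloisCohomology

end
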